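import Literature.Computability.Cryptography.LWESwitchRowProg
import Literature.Computability.Cryptography.LWEPrimePowerProgData
import HarnessLib

/-!
# The h₃ machine's rate-guess test as programs: the `j`-th subroutine query and the verdict

Topic `Computability/Cryptography` (LWE), grouping namespace `BLPRS2013.KProg`; sequel of `LWESwitchRowProg.lean` (the row `rowOf`
and the reference block `refOf` as programs against records) towards the MACHINE of hypothesis `h₃` of `BLPRSReduction.lean`
(pqc.S21). The machine runs BLPRS's Lemma 2.15 test (`LWERateGuessTest.flatGuessTest`, laws in `BLPRSMachineTestLaw.lean`) as a
NON-ADAPTIVE oracle transducer (`Complexity/TruthTableTransducers.lean`: compute the `j`-th subroutine input, run the given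
decision algorithm `D₃` on each with its own coins, post-process the answer bits): query `j < G·N` is row `w = j / N`, batch
`i = j % N` — the block of `m₃` input samples at positions `w·(N·m₃) + i·m₃ + [0, m₃)` pushed through the row program of guess `w`
(multiplier `κ̂_w = (A·D + w)/D`) on its own slice of coins — and query `G·N ≤ j < G·N + N'` is a reference block; the verdict
flags a gap `N·N' < T·|N'·cnt_w − N·cnt_ref|` for some row (`θ = 1/T`). This file writes the two maps at the level of lists and
proves them TYPED POLYNOMIAL TIME (everything PROVED, definitions with bodies, no named fact; their semantics against the
law-level test is the business of a forthcoming sequel):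

* `kRecWith`, `rRecW` (the row record of guess `w`), `TRec` (the test record), `blockOf`, **`tQueryOf`** (the `j`-th subroutine
  input `(samples for D₃, D₃'s coins)`), **`tVerdictOf`** (the gap test on the answer bits);
* `kRecWith_codeFP`, `rRecW_codeFP`, `blockOf_codeFP`, **`tQueryOf_codeFP`**, `cntOf_codeFP`, **`tVerdictOf_codeFP`**.

## References

* Z. Brakerski, A. Langlois, C. Peikert, O. Regev, D. Stehlé, *Classical hardness of learning with errors*, STOC 2013;
  arXiv:1306.0281, Lemma 2.15 (proof sketch: estimate the oracle's behaviour on each guess and on uniform samples, flag a gap),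
  Cor. 3.2 and §5. [BrakerskiEtAl2013]
* R. E. Ladner, N. A. Lynch, A. L. Selman, *A comparison of polynomial time reducibilities*, TCS 1 (1975), §3 (non-adaptive
  queries). [LadnerLynchSelman1975]
* S. Arora, B. Barak, *Computational Complexity: A Modern Approach*, CUP 2009, §1.3, §3.4, Def. 7.1. [AroraBarak2009]
-/

noncomputable section

namespace Literature.Computability.Cryptography

namespace BLPRS2013

namespace KProg

open Literature.Computability.Complexity Literature.Computability.Complexity.CodeFP
  Literature.Computability.QuantumComplexity Literature.Probability.Distributions GaussRejMachine GaussRejFP LWE.MP12.Prog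
open Literature.Algebra.EuclideanLattices (encodeRat encodeRat_injective)

/-! ### Records -/

/-- The kernel record with its multiplier replaced. [folklore] -/
def kRecWith (k : KRec) (κ : ℚ) : KRec := (k.1, (k.2.1, ((κ, k.2.2.1.2), k.2.2.2)))

/-- **The test record**: `(row record, (reference record, ((A, D), ((G, N, N', m₃), ((W_k, W_r, W_kr, ℓ₃, W), T)))))` — the row and
reference records of `LWESwitchRowProg.lean`, the grid base `A` and fineness `D` (binary), the counts (unary), the coin widths
(unary: kernel coins per row call, reference coins per block, the offset of the subroutine's coins, their length, the slice
width) and the threshold denominator `T` (binary). [folklore] -/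
abbrev TRec : Type := RRec × (FRec × ((ℕ × ℕ) × ((ℕ × ℕ × ℕ × ℕ) × ((ℕ × ℕ × ℕ × ℕ × ℕ) × ℕ))))

/-- Its code. [folklore] -/
abbrev tRecE : TRec → List Bool :=
  pairE rRecE (pairE fRecE (pairE (pairE natE natE) (pairE (pairE unE (pairE unE (pairE unE unE)))
    (pairE (pairE unE (pairE unE (pairE unE (pairE unE unE)))) natE))))

namespace TRec

variable (r : TRec)

/-- Row record. [folklore] -/
abbrev rr : RRec := r.1
/-- Reference record. [folklore] -/
abbrev fr : FRec := r.2.1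
/-- Grid base `A`. [folklore] -/
abbrev gA : ℕ := r.2.2.1.1
/-- Grid fineness `D`. [folklore] -/
abbrev gD : ℕ := r.2.2.1.2
/-- Number of guesses `G`. [folklore] -/
abbrev nG : ℕ := r.2.2.2.1.1
/-- Batches `N`. [folklore] -/
abbrev nN : ℕ := r.2.2.2.1.2.1
/-- Reference runs `N'`. [folklore] -/
abbrev nN' : ℕ := r.2.2.2.1.2.2.1
/-- Block size `m₃`. [folklore] -/
abbrev m3 : ℕ := r.2.2.2.1.2.2.2
/-- Kernel coins per row call `W_k`. [folklore] -/
abbrev wk : ℕ := r.2.2.2.2.1.1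
/-- Reference coins per block `W_r`. [folklore] -/
abbrev wr : ℕ := r.2.2.2.2.1.2.1
/-- Offset of the subroutine's coins `W_kr`. [folklore] -/
abbrev wkr : ℕ := r.2.2.2.2.1.2.2.1
/-- The subroutine's coins `ℓ₃`. [folklore] -/
abbrev l3 : ℕ := r.2.2.2.2.1.2.2.2.1
/-- Slice width `W`. [folklore] -/
abbrev ww : ℕ := r.2.2.2.2.1.2.2.2.2
/-- Threshold denominator `T`. [folklore] -/
abbrev tt : ℕ := r.2.2.2.2.2
/-- The dimension `n` (binary) for the sample header. [folklore] -/
abbrev dimN : ℕ := r.1.2.2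
/-- The modulus `q` for the sample header. [folklore] -/
abbrev modQ : ℕ := r.1.1.2.1.1

end TRec

/-- **The row record of guess `w`**: multiplier `κ̂_w = (A·D + w)/D`. [cite: BrakerskiEtAl2013, §5] -/
def rRecW (r : TRec) (w : ℕ) : RRec :=
  (kRecWith r.rr.1 ((((r.gA * r.gD + w : ℕ) : ℤ) : ℚ) / (r.gD : ℚ)), r.rr.2)

/-! ### The query and the verdict -/

/-- The block of `m₃` items of row `w`, batch `i` in the flat layout: positions `w·(N·m₃) + i·m₃ + [0, m₃)`. [cite: BrakerskiEtAl2013, Lemma 2.15] -/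
def blockOf (N m₃ : ℕ) (items : List LItem) (w i : ℕ) : List LItem := (items.drop (w * (N * m₃) + i * m₃)).take m₃

/-- **The `j`-th subroutine input**: the list-level samples handed to `D₃` (dimension, modulus, items) and `D₃`'s own coins, both
cut out of the `j`-th slice of width `W` of the coins. [cite: BrakerskiEtAl2013, Lemma 2.15 with §5; LadnerLynchSelman1975, §3] -/
def tQueryOf (r : TRec) (items : List LItem) (coins : List Bool) (j : ℕ) : LData × List Bool :=
  let slice := (coins.drop (j * r.ww)).take r.ww
  let dc := (slice.drop r.wkr).take r.l3
  if j < r.nG * r.nN then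
    ((r.dimN, (r.modQ, rowOf (rRecW r (j / r.nN)) (blockOf r.nN r.m3 items (j / r.nN) (j % r.nN), slice.take r.wk))), dc)
  else ((r.dimN, (r.modQ, refOf r.fr (slice.take r.wr))), dc)

/-- The count of accepting answers in a window. [folklore] -/
def cntOf (ans : List Bool) (off len : ℕ) : ℕ := ((ans.drop off).take len).count true

/-- **The verdict**: some row `w < G` shows a gap, `N·N' < T·|N'·cnt_w − N·cnt_ref|`. [cite: BrakerskiEtAl2013, Lemma 2.15 (proof sketch)] -/
def tVerdictOf (r : TRec) (ans : List Bool) : Bool :=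
  (List.range r.nG).any fun w =>
    decide (r.nN * r.nN' < r.tt * ((r.nN' : ℤ) * (cntOf ans (w * r.nN) r.nN : ℤ) - (r.nN : ℤ) * (cntOf ans (r.nG * r.nN) r.nN' : ℤ)).natAbs)

/-! ### Typed polynomial time -/

section CodeFP

/-- Replacing the multiplier is typed polynomial time. [folklore] -/
theorem kRecWith_codeFP : CodeFP (pairE kRecE encodeRat) kRecE (fun p => kRecWith p.1 p.2) := by
  have hk : CodeFP (pairE kRecE encodeRat) kRecE (fun p => p.1) := fst _ _
  have hκ : CodeFP (pairE kRecE encodeRat) encodeRat (fun p => p.2) := snd _ _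
  exact ((hk.fst'.pair (hk.snd'.fst'.pair ((hκ.pair hk.snd'.snd'.fst'.snd').pair hk.snd'.snd'.snd'))).congr fun p => rfl)

/-- **The row record of guess `w` is typed polynomial time** in `(record, w)` (`w` binary). [folklore] -/
theorem rRecW_codeFP : CodeFP (pairE tRecE natE) rRecE (fun p => rRecW p.1 p.2) := by
  have hr : CodeFP (pairE tRecE natE) tRecE (fun p => p.1) := fst _ _
  have hw : CodeFP (pairE tRecE natE) natE (fun p => p.2) := snd _ _
  have hA : CodeFP (pairE tRecE natE) natE (fun p => p.1.gA) := hr.snd'.snd'.fst'.fst'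
  have hD : CodeFP (pairE tRecE natE) natE (fun p => p.1.gD) := hr.snd'.snd'.fst'.snd'
  have hκ : CodeFP (pairE tRecE natE) encodeRat (fun p => (((p.1.gA * p.1.gD + p.2 : ℕ) : ℤ) : ℚ) / (p.1.gD : ℚ)) :=
    (ratOfIntNat.comp ((intOfNat.comp (natAdd.comp ((natMul.comp (hA.pair hD)).pair hw))).pair hD) :)
  exact (((kRecWith_codeFP.comp (hr.fst'.fst'.pair hκ)).pair hr.fst'.snd').congr fun p => rfl)

/-- The raw code of an item and of a block of items. [folklore] -/
abbrev itemRawE : LItem → List Bool := pairE (rawE natE) natE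

/-- **The block extraction is typed polynomial time** in `((N, m₃), items, (w, i))` (`N, m₃` unary, `w, i` binary; the offset is
computed in binary and capped by the length of the list). [folklore] -/
theorem blockOf_codeFP : CodeFP (pairE (pairE unE unE) (pairE (rawE itemRawE) (pairE natE natE))) (rawE itemRawE)
    (fun p => blockOf p.1.1 p.1.2 p.2.1 p.2.2.1 p.2.2.2) := by
  have hN : CodeFP (pairE (pairE unE unE) (pairE (rawE itemRawE) (pairE natE natE))) unE (fun p => p.1.1) := (fst _ _).fst'
  have hm : CodeFP (pairE (pairE unE unE) (pairE (rawE itemRawE) (pairE natE natE))) unE (fun p => p.1.2) := (fst _ _).snd'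
  have hl : CodeFP (pairE (pairE unE unE) (pairE (rawE itemRawE) (pairE natE natE))) (rawE itemRawE) (fun p => p.2.1) := (snd _ _).fst'
  have hw : CodeFP (pairE (pairE unE unE) (pairE (rawE itemRawE) (pairE natE natE))) natE (fun p => p.2.2.1) := (snd _ _).snd'.fst'
  have hi : CodeFP (pairE (pairE unE unE) (pairE (rawE itemRawE) (pairE natE natE))) natE (fun p => p.2.2.2) := (snd _ _).snd'.snd'
  have hoffN : CodeFP (pairE (pairE unE unE) (pairE (rawE itemRawE) (pairE natE natE))) natE
      (fun p => p.2.2.1 * (p.1.1 * p.1.2) + p.2.2.2 * p.1.2) :=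
    (natAdd.comp ((natMul.comp (hw.pair (natMul.comp ((natOfUn.comp hN).pair (natOfUn.comp hm))))).pair
      (natMul.comp (hi.pair (natOfUn.comp hm)))) :)
  have hoff : CodeFP (pairE (pairE unE unE) (pairE (rawE itemRawE) (pairE natE natE))) unE
      (fun p => min (p.2.2.1 * (p.1.1 * p.1.2) + p.2.2.2 * p.1.2) p.2.1.length) :=
    (unOfNatMin.comp (((ulength _).comp hl).pair hoffN) :)
  have h := (rawTakeUn itemRawE).comp (hm.pair ((rawDropUn itemRawE).comp (hoff.pair hl)))
  refine h.congr fun p => ?_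
  simp only [blockOf]
  congr 1
  rcases le_total (p.2.2.1 * (p.1.1 * p.1.2) + p.2.2.2 * p.1.2) p.2.1.length with hle | hle
  · rw [min_eq_left hle]
  · rw [min_eq_right hle, List.drop_of_length_le le_rfl, List.drop_of_length_le hle]

/-- The argument code of the query: `(record, (items, (coins, j)))` with `j` in binary. [folklore] -/
abbrev tqArgE : TRec × (List LItem × (List Bool × ℕ)) → List Bool := pairE tRecE (pairE (rawE itemRawE) (pairE strE natE))

/-- **The `j`-th subroutine input is typed polynomial time** in `(record, items, coins, j)`.
[cite: BrakerskiEtAl2013, Lemma 2.15 with §5; AroraBarak2009, §1.3] -/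
theorem tQueryOf_codeFP : CodeFP tqArgE (pairE (pairE natE (pairE natE (rawE itemRawE))) strE) (fun p => tQueryOf p.1 p.2.1 p.2.2.1 p.2.2.2) := by
  have hr : CodeFP tqArgE tRecE (fun p => p.1) := fst _ _
  have hitems : CodeFP tqArgE (rawE itemRawE) (fun p => p.2.1) := (snd _ _).fst'
  have hcoins : CodeFP tqArgE strE (fun p => p.2.2.1) := (snd _ _).snd'.fst'
  have hj : CodeFP tqArgE natE (fun p => p.2.2.2) := (snd _ _).snd'.snd'
  have hcnt : CodeFP tqArgE (pairE unE (pairE unE (pairE unE unE))) (fun p => p.1.2.2.2.1) := hr.snd'.snd'.snd'.fst'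
  have hG : CodeFP tqArgE unE (fun p => p.1.nG) := hcnt.fst'
  have hN : CodeFP tqArgE unE (fun p => p.1.nN) := hcnt.snd'.fst'
  have hm3 : CodeFP tqArgE unE (fun p => p.1.m3) := hcnt.snd'.snd'.snd'
  have hwid : CodeFP tqArgE (pairE unE (pairE unE (pairE unE (pairE unE unE)))) (fun p => p.1.2.2.2.2.1) := hr.snd'.snd'.snd'.snd'.fst'
  have hwk : CodeFP tqArgE unE (fun p => p.1.wk) := hwid.fst'
  have hwr : CodeFP tqArgE unE (fun p => p.1.wr) := hwid.snd'.fst'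
  have hwkr : CodeFP tqArgE unE (fun p => p.1.wkr) := hwid.snd'.snd'.fst'
  have hl3 : CodeFP tqArgE unE (fun p => p.1.l3) := hwid.snd'.snd'.snd'.fst'
  have hww : CodeFP tqArgE unE (fun p => p.1.ww) := hwid.snd'.snd'.snd'.snd'
  have hdim : CodeFP tqArgE natE (fun p => (p.1.dimN : ℕ)) := (natOfUn.comp hr.fst'.snd'.snd' :)
  have hmod : CodeFP tqArgE natE (fun p => p.1.modQ) := hr.fst'.fst'.snd'.fst'.fst'
  have hfr : CodeFP tqArgE fRecE (fun p => p.1.fr) := hr.snd'.fst'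
  -- the slice and the subroutine's coins
  have hjoff : CodeFP tqArgE unE (fun p => min (p.2.2.2 * p.1.ww) p.2.2.1.length) :=
    (unOfNatMin.comp ((strLength.comp hcoins).pair (natMul.comp (hj.pair (natOfUn.comp hww)))) :)
  have hslice : CodeFP tqArgE strE (fun p => (p.2.2.1.drop (min (p.2.2.2 * p.1.ww) p.2.2.1.length)).take p.1.ww) :=
    (strTake.comp (hww.pair (strDrop.comp (hjoff.pair hcoins))) :)
  have hslice' : CodeFP tqArgE strE (fun p => (p.2.2.1.drop (p.2.2.2 * p.1.ww)).take p.1.ww) :=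
    hslice.congr fun p => by rw [drop_min_length]
  have hdc : CodeFP tqArgE strE (fun p => (((p.2.2.1.drop (p.2.2.2 * p.1.ww)).take p.1.ww).drop p.1.wkr).take p.1.l3) :=
    (strTake.comp (hl3.pair (strDrop.comp (hwkr.pair hslice'))) :)
  -- the row query
  have hw : CodeFP tqArgE natE (fun p => p.2.2.2 / p.1.nN) := (natDiv.comp (hj.pair (natOfUn.comp hN)) :)
  have hi : CodeFP tqArgE natE (fun p => p.2.2.2 % p.1.nN) := (natMod.comp (hj.pair (natOfUn.comp hN)) :)
  have hblock : CodeFP tqArgE (rawE itemRawE) (fun p => blockOf p.1.nN p.1.m3 p.2.1 (p.2.2.2 / p.1.nN) (p.2.2.2 % p.1.nN)) :=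
    (blockOf_codeFP.comp ((hN.pair hm3).pair (hitems.pair (hw.pair hi))) :)
  have hrrec : CodeFP tqArgE rRecE (fun p => rRecW p.1 (p.2.2.2 / p.1.nN)) := (rRecW_codeFP.comp (hr.pair hw) :)
  have hrow : CodeFP tqArgE (rawE itemRawE) (fun p => rowOf (rRecW p.1 (p.2.2.2 / p.1.nN))
      (blockOf p.1.nN p.1.m3 p.2.1 (p.2.2.2 / p.1.nN) (p.2.2.2 % p.1.nN), ((p.2.2.1.drop (p.2.2.2 * p.1.ww)).take p.1.ww).take p.1.wk)) :=
    (rowOf_codeFP.comp (hrrec.pair (hblock.pair (strTake.comp (hwk.pair hslice')))) :)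
  have hrowQ : CodeFP tqArgE (pairE (pairE natE (pairE natE (rawE itemRawE))) strE) (fun p =>
      ((p.1.dimN, (p.1.modQ, rowOf (rRecW p.1 (p.2.2.2 / p.1.nN))
        (blockOf p.1.nN p.1.m3 p.2.1 (p.2.2.2 / p.1.nN) (p.2.2.2 % p.1.nN), ((p.2.2.1.drop (p.2.2.2 * p.1.ww)).take p.1.ww).take p.1.wk))),
        (((p.2.2.1.drop (p.2.2.2 * p.1.ww)).take p.1.ww).drop p.1.wkr).take p.1.l3)) :=
    (hdim.pair (hmod.pair hrow)).pair hdc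
  -- the reference query
  have href : CodeFP tqArgE (rawE itemRawE) (fun p => refOf p.1.fr (((p.2.2.1.drop (p.2.2.2 * p.1.ww)).take p.1.ww).take p.1.wr)) :=
    (refOf_codeFP.comp (hfr.pair (strTake.comp (hwr.pair hslice'))) :)
  have hrefQ : CodeFP tqArgE (pairE (pairE natE (pairE natE (rawE itemRawE))) strE) (fun p =>
      ((p.1.dimN, (p.1.modQ, refOf p.1.fr (((p.2.2.1.drop (p.2.2.2 * p.1.ww)).take p.1.ww).take p.1.wr))),
        (((p.2.2.1.drop (p.2.2.2 * p.1.ww)).take p.1.ww).drop p.1.wkr).take p.1.l3)) :=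
    (hdim.pair (hmod.pair href)).pair hdc
  -- the case split `j < G·N`
  have htest : CodeFP tqArgE bitE (fun p => decide (p.2.2.2 < p.1.nG * p.1.nN)) :=
    (natLt.comp (hj.pair (natMul.comp ((natOfUn.comp hG).pair (natOfUn.comp hN)))) :)
  refine (htest.ite hrowQ hrefQ).congr fun p => ?_
  unfold tQueryOf
  by_cases h : p.2.2.2 < p.1.nG * p.1.nN
  · rw [decide_eq_true h, if_pos h]; rfl
  · rw [decide_eq_false h, if_neg h]; rfl

/-- The window count is typed polynomial time in `(answers, (off, len))` (unary offsets). [folklore] -/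
theorem cntOf_codeFP : CodeFP (pairE (rawE bitE) (pairE unE unE)) natE (fun p => cntOf p.1 p.2.1 p.2.2) := by
  have ha : CodeFP (pairE (rawE bitE) (pairE unE unE)) (rawE bitE) (fun p => p.1) := fst _ _
  have hoff : CodeFP (pairE (rawE bitE) (pairE unE unE)) unE (fun p => p.2.1) := (snd _ _).fst'
  have hlen : CodeFP (pairE (rawE bitE) (pairE unE unE)) unE (fun p => p.2.2) := (snd _ _).snd'
  have hwin : CodeFP (pairE (rawE bitE) (pairE unE unE)) (rawE bitE) (fun p => (p.1.drop p.2.1).take p.2.2) :=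
    ((rawTakeUn bitE).comp (hlen.pair ((rawDropUn bitE).comp (hoff.pair ha))) :)
  have hfil : CodeFP (pairE (rawE bitE) (pairE unE unE)) (rawE bitE) (fun p => ((p.1.drop p.2.1).take p.2.2).filter fun b => b) := by
    have h := (filter (σ := Unit) (eσ := unitE) (eα := bitE) (p := fun t => t.2) (snd _ _)).comp ((const _ ()).pair hwin)
    exact h.congr fun p => rfl
  refine ((natLength bitE).comp hfil).congr fun p => ?_
  simp only [cntOf, List.count_eq_length_filter]
  congr 1
  exact List.filter_congr fun b _ => by cases b <;> rfl

/-- **The verdict is typed polynomial time** in `(record, answers)`. [cite: BrakerskiEtAl2013, Lemma 2.15 (proof sketch); AroraBarak2009, §1.3] -/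
theorem tVerdictOf_codeFP : CodeFP (pairE tRecE (rawE bitE)) bitE (fun p => tVerdictOf p.1 p.2) := by
  -- context `(record, answers)`, item `w` (binary)
  have hr : CodeFP (pairE (pairE tRecE (rawE bitE)) natE) tRecE (fun t => t.1.1) := (fst _ _).fst'
  have hans : CodeFP (pairE (pairE tRecE (rawE bitE)) natE) (rawE bitE) (fun t => t.1.2) := (fst _ _).snd'
  have hw : CodeFP (pairE (pairE tRecE (rawE bitE)) natE) natE (fun t => t.2) := snd _ _
  have hcnt : CodeFP (pairE (pairE tRecE (rawE bitE)) natE) (pairE unE (pairE unE (pairE unE unE))) (fun t => t.1.1.2.2.2.1) :=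
    hr.snd'.snd'.snd'.fst'
  have hG : CodeFP (pairE (pairE tRecE (rawE bitE)) natE) unE (fun t => t.1.1.nG) := hcnt.fst'
  have hN : CodeFP (pairE (pairE tRecE (rawE bitE)) natE) unE (fun t => t.1.1.nN) := hcnt.snd'.fst'
  have hN' : CodeFP (pairE (pairE tRecE (rawE bitE)) natE) unE (fun t => t.1.1.nN') := hcnt.snd'.snd'.fst'
  have hT : CodeFP (pairE (pairE tRecE (rawE bitE)) natE) natE (fun t => t.1.1.tt) := hr.snd'.snd'.snd'.snd'.snd'
  -- the two counts: offsets `w·N` and `G·N` in unary (capped by the number of answers; harmless for `drop`)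
  have hoffW : CodeFP (pairE (pairE tRecE (rawE bitE)) natE) unE (fun t => min (t.2 * t.1.1.nN) t.1.2.length) :=
    (unOfNatMin.comp (((ulength _).comp hans).pair (natMul.comp (hw.pair (natOfUn.comp hN)))) :)
  have hoffR : CodeFP (pairE (pairE tRecE (rawE bitE)) natE) unE (fun t => t.1.1.nG * t.1.1.nN) := (unMul_codeFP.comp (hG.pair hN) :)
  have hcw : CodeFP (pairE (pairE tRecE (rawE bitE)) natE) natE (fun t => cntOf t.1.2 (t.2 * t.1.1.nN) t.1.1.nN) :=
    (cntOf_codeFP.comp (hans.pair (hoffW.pair hN))).congr fun t => by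
      show cntOf t.1.2 (min (t.2 * t.1.1.nN) t.1.2.length) t.1.1.nN = cntOf t.1.2 (t.2 * t.1.1.nN) t.1.1.nN
      unfold cntOf
      rw [show List.drop (min (t.2 * TRec.nN t.1.1) (List.length t.1.2)) t.1.2 = List.drop (t.2 * TRec.nN t.1.1) t.1.2 from by
        rcases le_total (t.2 * t.1.1.nN) t.1.2.length with hle | hle
        · rw [min_eq_left hle]
        · rw [min_eq_right hle, List.drop_of_length_le le_rfl, List.drop_of_length_le hle]]
  have hcr : CodeFP (pairE (pairE tRecE (rawE bitE)) natE) natE (fun t => cntOf t.1.2 (t.1.1.nG * t.1.1.nN) t.1.1.nN') :=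
    (cntOf_codeFP.comp (hans.pair (hoffR.pair hN')) :)
  -- the integer test
  have hdiff : CodeFP (pairE (pairE tRecE (rawE bitE)) natE) natE (fun t =>
      ((t.1.1.nN' : ℤ) * (cntOf t.1.2 (t.2 * t.1.1.nN) t.1.1.nN : ℤ) - (t.1.1.nN : ℤ) * (cntOf t.1.2 (t.1.1.nG * t.1.1.nN) t.1.1.nN' : ℤ)).natAbs) :=
    (intNatAbs.comp (intSub.comp ((intMul.comp ((intOfNat.comp (natOfUn.comp hN')).pair (intOfNat.comp hcw))).pair
      (intMul.comp ((intOfNat.comp (natOfUn.comp hN)).pair (intOfNat.comp hcr))))) :)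
  have hpred : CodeFP (pairE (pairE tRecE (rawE bitE)) natE) bitE (fun t =>
      decide (t.1.1.nN * t.1.1.nN' < t.1.1.tt * ((t.1.1.nN' : ℤ) * (cntOf t.1.2 (t.2 * t.1.1.nN) t.1.1.nN : ℤ) -
        (t.1.1.nN : ℤ) * (cntOf t.1.2 (t.1.1.nG * t.1.1.nN) t.1.1.nN' : ℤ)).natAbs)) :=
    (natLt.comp ((natMul.comp ((natOfUn.comp hN).pair (natOfUn.comp hN'))).pair (natMul.comp (hT.pair hdiff))) :)
  -- `any` over `w ∈ [0, G)`
  have hrange : CodeFP (pairE tRecE (rawE bitE)) (rawE natE) (fun p => List.range p.1.nG) :=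
    (urange.comp (fst _ _).snd'.snd'.snd'.fst'.fst' :)
  have hany := (any hpred).comp ((CodeFP.id _).pair hrange)
  exact hany.congr fun p => rfl

end CodeFP

end KProg

end BLPRS2013

end Literature.Computability.Cryptography

end
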